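import Literature.AlgebraicGeometry.Resolution.NewtonNondegenerate
import Mathlib.Algebra.MvPolynomial.PDeriv
import HarnessLib

/-!
# Q8a (W-ND, the tame class rung), INTERFACE: Newton non-degeneracy of a POLYNOMIAL read in polynomial terms — the initial form along a positive integer weight
# is a polynomial, and non-degeneracy gives, at every `k`-rational torus point, a non-vanishing partial derivative of it
# (crux `FInjectiveMacaulayfication` stmt-ResolutionOfSingularities-15315, chain w45a; res-L1-w45a-plan-1 RULING R21.4 (2) «Q8a: Ishii's chart Lemma 4.4.24 as a tree
# theorem»; seat res-L1-w45a-stub-1 g12; source of the definitions: `Literature.AlgebraicGeometry.Resolution.NewtonNondegenerate` (Boubakri–Greuel–Markwig §3) —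
# Ishii 1997 Def. 4.4.22 is that file's `IsNewtonNondegenerate` verbatim [corpus:book:ishii1997-introduction-singularities p.95])

[OURS · L1 W4.5a] Support file (`--supports stmt-ResolutionOfSingularities-15315 --as helper`); def-free; UNCONDITIONAL; no named fact. NOT a statement of any manuscript.
AI-written (AI review is weaker than expert review).

For a polynomial `f ∈ k[X_0..X_{m-1}]` (coerced to `k⟦X⟧`), a weight `w : Fin m → ℕ` with all `wᵢ > 0`, and the set `F` of exponents of `f` of MINIMAL `w`-weight:
* `supp_coe`, `wdeg_natCast`, ★ `initialForm_coe` — `initialForm (w : ℝ-weights) ↑f = ↑(Σ_{α ∈ F} a_α X^α)` (the initial form of BGM/Ishii along the compact face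
  exposed by `w` IS the face polynomial);
* `pderiv_coe` — the tree's power-series `∂/∂Xᵢ` (`PowerSeriesRegularLocal`) agrees with `MvPolynomial.pderiv` on polynomials; `evalAt_coe` — BGM's `evalAt` is `MvPolynomial.eval`;
* ★★ `exists_eval_pderiv_ne_zero_of_isNewtonNondegenerate` — **if `f` is Newton non-degenerate then at every `k`-rational point `q` of the torus some `∂f_F/∂X_j (q) ≠ 0`**
  (`f_F` the face polynomial of any positive integer weight). This is the only use of non-degeneracy in Ishii's Lemma 4.4.24 (sequel file `…NewtonChartLemma`).
[cite: IshiiSingularities2018, Def. 4.4.22 (p. 95)] [cite: BoubakriGreuelMarkwig2010, §3 (p. 10)]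
-/

-- single-problem summit: the doubled namespace component is forced
set_option linter.dupNamespace false

noncomputable section

open MvPolynomial

namespace Summit.ResolutionOfSingularities.ResolutionOfSingularities.Theorems.FInjectiveMacaulayfication.NewtonChartLemma

open Literature.AlgebraicGeometry.Resolution Literature.AlgebraicGeometry.Resolution.BoubakriGreuelMarkwig

variable {k : Type} [Field k] {m : ℕ}

/-- The BGM support of a polynomial (as a power series) is its `MvPolynomial.support`. [plumbing] -/
theorem supp_coe (f : MvPolynomial (Fin m) k) : supp (f : MvPowerSeries (Fin m) k) = (f.support : Set (Fin m →₀ ℕ)) := by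
  ext α
  simp [supp, MvPolynomial.coeff_coe, MvPolynomial.mem_support_iff]

/-- The real `w`-weight of an exponent for an integer weight vector is the cast of the integer weight `Σ wⱼ αⱼ`. [plumbing] -/
theorem wdeg_natCast (w : Fin m → ℕ) (α : Fin m →₀ ℕ) : wdeg (fun i => (w i : ℝ)) α = ((∑ j, w j * α j : ℕ) : ℝ) := by
  simp [wdeg, pairing, expPt]

/-- ★ **The initial form of a polynomial along a positive integer weight is its face polynomial**: with `F` the exponents of `f` of minimal `w`-weight,
`initialForm w ↑f = ↑(Σ_{α ∈ F} a_α X^α)`. [cite: BoubakriGreuelMarkwig2010, §3 (p. 10)] -/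
theorem initialForm_coe (f : MvPolynomial (Fin m) k) (w : Fin m → ℕ) (F : Finset (Fin m →₀ ℕ))
    (hF : ∀ α, α ∈ F ↔ α ∈ f.support ∧ ∀ β ∈ f.support, ∑ j, w j * α j ≤ ∑ j, w j * β j) :
    initialForm (fun i => (w i : ℝ)) (f : MvPowerSeries (Fin m) k) = ((∑ α ∈ F, monomial α (coeff α f) : MvPolynomial (Fin m) k) : MvPowerSeries (Fin m) k) := by
  classical
  ext α
  rw [MvPolynomial.coeff_coe, coeff_sum]
  simp only [coeff_monomial, Finset.sum_ite_eq']
  rw [MvPowerSeries.coeff_apply]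
  unfold initialForm
  have key : (α ∈ supp (f : MvPowerSeries (Fin m) k) ∧ ∀ β ∈ supp (f : MvPowerSeries (Fin m) k), wdeg (fun i => (w i : ℝ)) α ≤ wdeg (fun i => (w i : ℝ)) β) ↔ α ∈ F := by
    rw [hF, supp_coe]
    simp only [Finset.mem_coe, wdeg_natCast, Nat.cast_le]
  by_cases hα : α ∈ F
  · rw [if_pos (key.mpr hα), if_pos hα, MvPolynomial.coeff_coe]
  · rw [if_neg (fun h => hα (key.mp h)), if_neg hα]

/-- The tree's power-series partial derivative agrees with `MvPolynomial.pderiv` on polynomials. [folklore] -/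
theorem pderiv_coe (i : Fin m) (P : MvPolynomial (Fin m) k) :
    MvPowerSeries.pderiv i (P : MvPowerSeries (Fin m) k) = ((pderiv i P : MvPolynomial (Fin m) k) : MvPowerSeries (Fin m) k) := by
  ext e
  rw [MvPowerSeries.coeff_pderiv, MvPolynomial.coeff_coe, MvPolynomial.coeff_coe, MvPolynomial.coeff_pderiv, mul_comm]

/-- BGM's finitely supported evaluation `evalAt` is `MvPolynomial.eval` on polynomials. [folklore] -/
theorem evalAt_coe (P : MvPolynomial (Fin m) k) (q : Fin m → k) : evalAt (P : MvPowerSeries (Fin m) k) q = MvPolynomial.eval q P := by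
  classical
  unfold evalAt
  rw [finsum_eq_sum_of_support_subset (s := P.support)]
  · rw [MvPolynomial.eval_eq']
    exact Finset.sum_congr rfl fun α _ => by rw [MvPolynomial.coeff_coe]
  · intro α hα
    rw [Function.mem_support, MvPolynomial.coeff_coe] at hα
    exact Finset.mem_coe.mpr (MvPolynomial.mem_support_iff.mpr fun h => hα (by rw [h, zero_mul]))

/-- ★★ **NON-DEGENERACY IN POLYNOMIAL TERMS**: if the polynomial `f` is Newton non-degenerate (Ishii Def. 4.4.22 = BGM NND), then for every positive integer weight `w`, with
`f_F = Σ_{α ∈ F} a_α X^α` its face polynomial (`F` = exponents of minimal `w`-weight), and every `k`-rational torus point `q` (all `qᵢ ≠ 0`), SOME `∂f_F/∂X_j (q) ≠ 0`.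
[cite: IshiiSingularities2018, Def. 4.4.22 (p. 95); BoubakriGreuelMarkwig2010, §3 (p. 10)] -/
theorem exists_eval_pderiv_ne_zero_of_isNewtonNondegenerate (f : MvPolynomial (Fin m) k) (hND : IsNewtonNondegenerate (f : MvPowerSeries (Fin m) k))
    (w : Fin m → ℕ) (hw : ∀ i, 0 < w i) (F : Finset (Fin m →₀ ℕ))
    (hF : ∀ α, α ∈ F ↔ α ∈ f.support ∧ ∀ β ∈ f.support, ∑ j, w j * α j ≤ ∑ j, w j * β j)
    (q : Fin m → k) (hq : ∀ i, q i ≠ 0) :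
    ∃ j : Fin m, MvPolynomial.eval q (pderiv j (∑ α ∈ F, monomial α (coeff α f))) ≠ 0 := by
  have h := hND (fun i => (w i : ℝ)) (fun i => by exact_mod_cast hw i) q hq
  unfold IsJacobianZero at h
  rw [initialForm_coe f w F hF] at h
  simp only [pderiv_coe, evalAt_coe] at h
  by_contra hcon
  push Not at hcon
  exact h hcon

end Summit.ResolutionOfSingularities.ResolutionOfSingularities.Theorems.FInjectiveMacaulayfication.NewtonChartLemma

end
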